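import Literature.AlgebraicGeometry.HodgeTheory.GAGAJunkGraphChow
import Literature.AlgebraicGeometry.Motives.ClosedGraphMorphismImmersion
import Literature.AlgebraicGeometry.Motives.OpenImmersionGraph
import HarnessLib

/-!
# GAGA: a function that is locally (holomorphic unit) · (rational) is a regular function

J.-P. Serre, *Géométrie algébrique et géométrie analytique*, Ann. Inst. Fourier 6 (1956), n° 20
Remarque 1 («toute fonction méromorphe sur une variété projective est rationnelle»), via Chow's
theorem on the graph and Zariski's Main Theorem (D. Mumford, *Algebraic Geometry I* (1981), §4B
(4.14): «By Chow's theorem, `Γ_f` is a closed algebraic subset … By Zariski's Main Theorem, `Γ_f`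
is regular»). Let `X` be smooth projective over `ℂ` with analytification `φ : M → X(ℂ)`, `T ⊆ X`
open, and `g : M → ℂ` locally of the form `g · b(φ ·) = u · a(φ ·)` over `T` (`u` holomorphic and
nowhere zero, `a, b ∈ Γ(X, W)`, `T ∩ W = D(a) ∩ D(b)` on complex points) — hypothesis `H` of
`GAGAJunkGraphChow`. By `exists_isClosed_junkGraph` the junk graph of `g` is the set of complex
points of a Zariski-closed `Z ⊆ X ×_ℂ ℙ¹`. This file proves:

* `exists_hom_openOver_projectiveSpace_of_locally_unit_mul_div` — over the OPEN SUBSCHEME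
  `T ⊆ X` (`OpenGraph.openOver X T`, a normal variety: smooth, `X` integral), the restriction of
  `Z` is a closed graph, hence the graph of a morphism `T ⟶ ℙ¹_ℂ` (the tree's Zariski-Main-Theorem
  step `Motives.exists_hom_forall_comp_eq_of_isClosed`), which lands in the chart `D₊(x₀)`
  (Jacobson, `Motives.range_subset_of_isLocallyClosed_of_forall_pt_mem`);
* `exists_section_eval_eq_of_locally_unit_mul_div` — **`g` is a regular function on `T`**: there is
  `c ∈ Γ(X, T)` with `c(φ m) = g m` whenever `φ m ∈ T(ℂ)` (pull back the affine coordinate `x₁/x₀`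
  along the lift `T ⟶ D₊(x₀) = Spec ℂ[x₀, x₁]_{(x₀)}`).

Consumer: GAGA injectivity on `Pic` (`GAGAPicardInjective`). Everything here is proved; no
definitions, no named facts.

## References

* [SerreGAGA1956] J.-P. Serre, Géométrie algébrique et géométrie analytique, Ann. Inst. Fourier 6
  (1956), n° 19 Prop. 13, n° 20 Remarque 1 (pp. 29–32).
* [Mumford1981] D. Mumford, Algebraic Geometry I: Complex Projective Varieties (1981), §4B (4.14),
  p. 67.
* [MumfordAV1970] D. Mumford, Abelian Varieties (1970), §4 (closed graphs over normal varieties).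
-/

noncomputable section

open scoped Manifold ContDiff Topology LinearAlgebra.Projectivization
open CategoryTheory AlgebraicGeometry MonoidalCategory Set
open Literature.AlgebraicGeometry.Motives (AlgPoints ComplexPoints SchemeOver IsSmoothProjective
  projectiveSpace)
open Literature.AlgebraicGeometry.Motives.AlgPoints (evalOrZero)
open Literature.AlgebraicGeometry.Motives.OpenGraph (openOver openOverι)
open Literature.NumberTheory.Transcendental

namespace Literature.AlgebraicGeometry.HodgeTheory

section Main

variable {n : ℕ} {X : SchemeOver ℂ}
  {E : Type*} [NormedAddCommGroup E] [NormedSpace ℂ E] [FiniteDimensional ℂ E]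
  {M : Type*} [TopologicalSpace M] [ChartedSpace E M] [IsManifold 𝓘(ℂ, E) ω M]
  {φ : M → ComplexPoints X}

/-- **The junk graph over `T` is the graph of a morphism `T ⟶ ℙ¹` through `D₊(x₀)`.** With
`X`, `φ`, `T`, `g`, `H` as in `exists_isClosed_junkGraph` and `T` non-empty: there is a morphism
`ψ : T ⟶ ℙ¹_ℂ` from the open subscheme `T ⊆ X` (over `ℂ`) which on complex points is
`x ↦ [1 : g(φ⁻¹ x)]`, i.e. `x ↦` the image of the chart point of `D₊(x₀) = Spec ℂ[x₀, x₁]_{(x₀)}`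
with homogeneous coordinates `(1, g(φ⁻¹ x))`. Proof: restrict the Zariski-closed junk graph
`Z ⊆ X ×_ℂ ℙ¹` to `T ×_ℂ ℙ¹`, where its `ℂ`-points are exactly the pairs `(x, [1 : g(φ⁻¹ x)])`, and
apply the closed-graph principle over the normal variety `T` (Zariski's Main Theorem,
`Motives.exists_hom_forall_comp_eq_of_isClosed`). [cite: Mumford1981, §4B (4.14), p. 67]
[cite: MumfordAV1970, §4] -/
theorem exists_hom_openOver_projectiveSpace_of_locally_unit_mul_div (hX : IsSmoothProjective n X)
    (hφ : IsAnalytification E X n φ) (T : X.left.Opens) (hT : (T : Set X.left).Nonempty) (g : M → ℂ)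
    (H : ∀ m : M, ∃ (W : X.left.Opens) (a b : Γ(X.left, W)) (u : M → ℂ), (φ m).pt ∈ W ∧
      MDifferentiableOn 𝓘(ℂ, E) 𝓘(ℂ, ℂ) u (φ ⁻¹' {P | P.pt ∈ W}) ∧
      ∀ m', (φ m').pt ∈ W → u m' ≠ 0 ∧
        ((φ m').pt ∈ T ↔ evalOrZero W a (φ m') ≠ 0 ∧ evalOrZero W b (φ m') ≠ 0) ∧
        ((φ m').pt ∈ T → g m' * evalOrZero W b (φ m') = u m' * evalOrZero W a (φ m'))) :
    ∃ ψ : openOver X T ⟶ projectiveSpace 1 ℂ, ∀ x : ComplexPoints (openOver X T),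
      AlgPoints.map ψ x = AlgPoints.map (chartι 1 0)
        (chartPoint 1 ![1, g (hφ.homeomorph.symm (AlgPoints.map (openOverι X T) x))]
          (by simp)) := by
  classical
  haveI : IsIntegral X.left := IsSmoothProjective.isIntegral_holds hX
  haveI : SmoothOfRelativeDimension n X.hom := hX.smoothOfRelativeDimension
  haveI : Smooth X.hom := SmoothOfRelativeDimension.smooth n X.hom
  haveI : LocallyOfFiniteType X.hom := inferInstance
  -- the open subscheme `T` as a `ℂ`-scheme: integral, locally of finite type, normal
  haveI : Nonempty (T : Scheme) := by
    obtain ⟨x, hx⟩ := hT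
    exact ⟨⟨x, hx⟩⟩
  haveI : IsIntegral (T : Scheme) := isIntegral_of_isOpenImmersion T.ι
  haveI : IsIntegral (openOver X T).left := this
  haveI : LocallyOfFiniteType (openOver X T).hom := by
    change LocallyOfFiniteType (T.ι ≫ X.hom)
    infer_instance
  have hTn : ∀ t : (openOver X T).left, IsIntegrallyClosed ((openOver X T).left.presheaf.stalk t) := by
    intro t
    haveI := Literature.AlgebraicGeometry.Motives.isIntegrallyClosed_stalk_of_isSmoothProjective hX t.1
    exact IsIntegrallyClosed.of_equiv (T.stalkIso t).symm.commRingCatIsoToRingEquiv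
  haveI : IsProper (projectiveSpace 1 ℂ).hom := inferInstance
  -- the Zariski-closed junk graph and its restriction to `T ×_ℂ ℙ¹`
  obtain ⟨Z, hZc, hZ⟩ := exists_isClosed_junkGraph hX hφ T g H
  set ι := openOverι X T with hι
  set Γ' : Set ↥(openOver X T ⊗ projectiveSpace 1 ℂ).left :=
    (ι ▷ projectiveSpace 1 ℂ).left.base ⁻¹' Z with hΓ'
  have hΓ'c : IsClosed Γ' := hZc.preimage (ι ▷ projectiveSpace 1 ℂ).left.base.hom.continuous
  -- the map on complex points
  obtain ⟨φ₀, hφ₀⟩ : ∃ φ₀ : AlgPoints (openOver X T) ℂ → AlgPoints (projectiveSpace 1 ℂ) ℂ,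
      φ₀ = fun x ↦ AlgPoints.map (chartι 1 0)
        (chartPoint 1 ![1, g (hφ.homeomorph.symm (AlgPoints.map ι x))] (by simp)) := ⟨_, rfl⟩
  have hφ₀' : ∀ x, φ₀ x = projPoint 1
      (Projectivization.mk ℂ ![1, g (hφ.homeomorph.symm (AlgPoints.map ι x))] (by simp)) := by
    intro x
    rw [hφ₀]
    exact (projPoint_mk_eq_map_chartPoint (n := 1) (i := 0) _ (by simp)).symm
  -- the points of `T` map into `T`
  have hιT : ∀ x : AlgPoints (openOver X T) ℂ, (AlgPoints.map ι x).pt ∈ T := by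
    intro x
    rw [AlgPoints.pt_map, hι, Literature.AlgebraicGeometry.Motives.OpenGraph.openOverι_left]
    exact (x.pt).2
  have key : ∀ (x : AlgPoints (openOver X T) ℂ) (y : AlgPoints (projectiveSpace 1 ℂ) ℂ),
      AlgPoints.pt (CartesianMonoidalCategory.lift x y : AlgPoints (openOver X T ⊗ projectiveSpace 1 ℂ) ℂ)
        ∈ Γ' ↔ y = φ₀ x := by
    intro x y
    have h1 : AlgPoints.pt (CartesianMonoidalCategory.lift x y :
        AlgPoints (openOver X T ⊗ projectiveSpace 1 ℂ) ℂ) ∈ Γ' ↔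
        AlgPoints.pt (AlgPoints.map (ι ▷ projectiveSpace 1 ℂ) (CartesianMonoidalCategory.lift x y)) ∈ Z := by
      rw [AlgPoints.pt_map]
      rfl
    rw [h1, AlgPoints.map_apply, CartesianMonoidalCategory.lift_whiskerRight, ← AlgPoints.map_apply ι x,
      hZ (AlgPoints.map ι x) y, hφ₀']
    exact ⟨fun h ↦ h (hιT x), fun h _ ↦ h⟩
  obtain ⟨ψ, hψ⟩ := Literature.AlgebraicGeometry.Motives.exists_hom_forall_comp_eq_of_isClosed
    (T := openOver X T) (P := projectiveSpace 1 ℂ) hTn Γ' hΓ'c φ₀ key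
  refine ⟨ψ, fun x ↦ ?_⟩
  rw [AlgPoints.map_apply, hψ x, hφ₀]

/-- **A function that is locally (holomorphic unit) · (rational) is regular.** Let `X` be smooth
projective over `ℂ` with analytification `φ : M → X(ℂ)` (holomorphic atlas), `T ⊆ X` open, and
`g : M → ℂ` such that every point of `M` has a neighbourhood `φ⁻¹(W(ℂ))` (`W ⊆ X` open) with
sections `a, b ∈ Γ(X, W)` and `u : M → ℂ` holomorphic and nowhere zero on `φ⁻¹(W(ℂ))` such that
`T ∩ W = D(a) ∩ D(b)` on complex points and `g · b(φ ·) = u · a(φ ·)` over `T`. Then `g` is the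
analytification of a REGULAR function on `T`: there is `c ∈ Γ(X, T)` with `c(φ m) = g m` for all
`m` with `φ m ∈ T(ℂ)`. Proof: the morphism `T ⟶ ℙ¹_ℂ` of
`exists_hom_openOver_projectiveSpace_of_locally_unit_mul_div` has image in `D₊(x₀)` (all its
complex points do; Jacobson), so it lifts to `T ⟶ Spec ℂ[x₀, x₁]_{(x₀)}`; pull back the coordinate
`x₁/x₀`. This is Serre's «fonction méromorphe ⇒ rationnelle» for meromorphic functions with
algebraically controlled zeros and poles. [cite: SerreGAGA1956, n° 20 Remarque 1]
[cite: Mumford1981, §4B (4.14), p. 67] -/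
theorem exists_section_eval_eq_of_locally_unit_mul_div (hX : IsSmoothProjective n X)
    (hφ : IsAnalytification E X n φ) (T : X.left.Opens) (g : M → ℂ)
    (H : ∀ m : M, ∃ (W : X.left.Opens) (a b : Γ(X.left, W)) (u : M → ℂ), (φ m).pt ∈ W ∧
      MDifferentiableOn 𝓘(ℂ, E) 𝓘(ℂ, ℂ) u (φ ⁻¹' {P | P.pt ∈ W}) ∧
      ∀ m', (φ m').pt ∈ W → u m' ≠ 0 ∧
        ((φ m').pt ∈ T ↔ evalOrZero W a (φ m') ≠ 0 ∧ evalOrZero W b (φ m') ≠ 0) ∧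
        ((φ m').pt ∈ T → g m' * evalOrZero W b (φ m') = u m' * evalOrZero W a (φ m'))) :
    ∃ c : Γ(X.left, T), ∀ m : M, (φ m).pt ∈ T → evalOrZero T c (φ m) = g m := by
  classical
  by_cases hT : (T : Set X.left).Nonempty
  swap
  · exact ⟨0, fun m hm ↦ (hT ⟨(φ m).pt, hm⟩).elim⟩
  haveI : IsIntegral X.left := IsSmoothProjective.isIntegral_holds hX
  haveI : SmoothOfRelativeDimension n X.hom := hX.smoothOfRelativeDimension
  haveI : Smooth X.hom := SmoothOfRelativeDimension.smooth n X.hom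
  haveI : LocallyOfFiniteType X.hom := inferInstance
  haveI : LocallyOfFiniteType (openOver X T).hom := by
    change LocallyOfFiniteType (T.ι ≫ X.hom)
    infer_instance
  obtain ⟨ψ, hψ⟩ := exists_hom_openOver_projectiveSpace_of_locally_unit_mul_div hX hφ T hT g H
  set ι := openOverι X T with hι
  haveI : IsOpenImmersion ι.left := by
    rw [hι]
    change IsOpenImmersion T.ι
    infer_instance
  -- `ψ` lands in the chart `D₊(x₀)`: all its complex points do (Jacobson)
  have hrange : Set.range ψ.left.base ⊆ Set.range (chartι 1 0).left.base := by
    refine Literature.AlgebraicGeometry.Motives.range_subset_of_isLocallyClosed_of_forall_pt_mem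
      (T := openOver X T) ψ.left (chartι 1 0).left.isOpenEmbedding.isOpen_range.isLocallyClosed
      fun x ↦ ?_
    have h1 : ψ.left.base x.pt = (AlgPoints.map ψ x).pt := (AlgPoints.pt_map ψ x).symm
    rw [h1, hψ x, AlgPoints.pt_map]
    exact ⟨_, rfl⟩
  -- lift `ψ` through the open immersion `D₊(x₀) = Spec ℂ[x₀, x₁]_{(x₀)} ⟶ ℙ¹`
  set ψ₀ : (openOver X T).left ⟶ (chartScheme 1 0).left :=
    IsOpenImmersion.lift (chartι 1 0).left ψ.left hrange with hψ₀
  have hψ₀fac : ψ₀ ≫ (chartι 1 0).left = ψ.left := IsOpenImmersion.lift_fac _ _ _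
  set ψ' : openOver X T ⟶ chartScheme 1 0 := Over.homMk ψ₀ (by
    rw [← Over.w (chartι 1 0), ← Category.assoc, hψ₀fac]
    exact Over.w ψ) with hψ'
  have hψ'ι : ψ' ≫ chartι 1 0 = ψ := by
    ext : 1
    simp only [hψ', Over.comp_left, Over.homMk_left]
    exact hψ₀fac
  -- the complex points of `T` map to the chart points with coordinates `(1, g(φ⁻¹ x))`
  have hψ'pt : ∀ x : ComplexPoints (openOver X T), AlgPoints.map ψ' x =
      chartPoint 1 ![1, g (hφ.homeomorph.symm (AlgPoints.map ι x))] (by simp) := by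
    intro x
    apply Literature.AlgebraicGeometry.Motives.AlgPoints.map_injective (chartι 1 0)
    rw [← hψ x, AlgPoints.map_apply, AlgPoints.map_apply, AlgPoints.map_apply, Category.assoc, hψ'ι]
  -- the pulled-back coordinate `x₁/x₀`
  set c' : Γ((openOver X T).left, ⊤) := ψ'.left.appTop (coordSection 1 0 1) with hc'
  have hc'eval : ∀ x : ComplexPoints (openOver X T),
      evalOrZero ⊤ c' x = g (hφ.homeomorph.symm (AlgPoints.map ι x)) := by
    intro x
    have htop : (AlgPoints.map ψ' x).pt ∈ (⊤ : (chartScheme 1 0).left.Opens) := trivial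
    have h1 := AlgPoints.eval_map ψ' x ⊤ htop (coordSection 1 0 1)
    rw [AlgPoints.evalOrZero_of_mem c' (show x.pt ∈ (⊤ : (openOver X T).left.Opens) from trivial)]
    change x.eval (ψ'.left ⁻¹ᵁ ⊤) trivial (ψ'.left.app ⊤ (coordSection 1 0 1)) = _
    rw [← h1]
    have h2 : (AlgPoints.map ψ' x).eval ⊤ htop (coordSection 1 0 1) =
        (chartPoint 1 ![1, g (hφ.homeomorph.symm (AlgPoints.map ι x))] (by simp)).eval ⊤
          trivial (coordSection 1 0 1) := by
      congr 1
      exact hψ'pt x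
    rw [h2, eval_coordSection_chartPoint]
    simp
  -- transport `c'` to a section of `X` over `T`
  refine ⟨T.topIso.hom c', fun m hm ↦ ?_⟩
  have hmr : (φ m).pt ∈ ι.left.opensRange := by
    change (φ m).pt ∈ T.ι.opensRange
    rw [Scheme.Opens.opensRange_ι]
    exact hm
  set x := Literature.AlgebraicGeometry.Motives.AlgPoints.liftOfMemOpensRange ι (φ m) hmr with hx
  have hιx : AlgPoints.map ι x = φ m :=
    Literature.AlgebraicGeometry.Motives.AlgPoints.map_liftOfMemOpensRange ι (φ m) hmr
  have hmx : hφ.homeomorph.symm (AlgPoints.map ι x) = m := by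
    rw [hιx]
    exact hφ.homeomorph.symm_apply_apply m
  have hxT' : (AlgPoints.map ι x).pt ∈ T := by
    rw [hιx]
    exact hm
  have hxT : x.pt ∈ ι.left ⁻¹ᵁ T := hxT'
  -- evaluation at `φ m = ι(x)` is evaluation of `ι^* c` at `x`
  have hev : evalOrZero T (T.topIso.hom c') (AlgPoints.map ι x) =
      evalOrZero (ι.left ⁻¹ᵁ T) (ι.left.app T (T.topIso.hom c')) x := by
    rw [AlgPoints.evalOrZero_of_mem _ hxT', AlgPoints.eval_map ι x T hxT' (T.topIso.hom c'),
      ← AlgPoints.evalOrZero_of_mem _ hxT]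
  -- `ι^*` of the transported section is the restriction of `c'` from `⊤`
  have hsec : ι.left.app T (T.topIso.hom c') =
      (openOver X T).left.presheaf.map (homOfLE (le_top : ι.left ⁻¹ᵁ T ≤ ⊤)).op c' := by
    have hmor : T.topIso.hom ≫ T.ι.app T =
        (T : Scheme).presheaf.map (homOfLE (le_top : T.ι ⁻¹ᵁ T ≤ ⊤)).op := by
      rw [Scheme.Opens.topIso_hom, Scheme.Opens.ι_app, Scheme.Opens.toScheme_presheaf_map]
      change X.left.presheaf.map _ ≫ X.left.presheaf.map _ = X.left.presheaf.map _
      rw [← Functor.map_comp]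
      exact congrArg _ (Subsingleton.elim _ _)
    have h2 := ConcreteCategory.congr_hom hmor c'
    rw [ConcreteCategory.comp_apply] at h2
    exact h2
  rw [← hιx, hev, hsec, AlgPoints.evalOrZero_map_homOfLE (X := openOver X T) le_top c' hxT, hc'eval x, hmx]

end Main

end Literature.AlgebraicGeometry.HodgeTheory
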